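import Literature.Probability.RandomGraphs.PlantedCliqueFacts
import Literature.Probability.RandomGraphs.PlantedCliqueUnique
import Literature.Probability.RandomGraphs.PlantedCliqueSuccess
import Literature.Probability.RandomGraphs.PlantedCliqueProgramFP
import Literature.Computability.Complexity.RandomizedProofs
import HarnessLib

/-!
# Discharge of `aks_unique` and `aks_recovery` (Alon–Krivelevich–Sudakov 1998)

`aks_unique` (`PlantedCliqueFacts.lean`) is the uniqueness clause of Alon–Krivelevich–Sudakov
1998, §1 (last paragraph: "there is a polynomial time algorithm that finds, almost surely, the
unique largest clique of size `k` in `G(n, 1/2, k)`, provided `k ≥ ε n^{1/2}`") and §3: for every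
`c > 0` and every clique-size sequence `k` with `c √n ≤ k n ≤ n` eventually
(`InSqrtRegime c k`), the planted `k n`-set is the unique maximum clique of `G(n, 1/2, k n)` with
probability `→ 1` (`PlantedCliqueUniqueWhp k`). AKS use this without spelling out the routine
first-moment argument; that argument is PROVED in `PlantedCliqueUnique.lean`
(`plantedCliqueUniqueWhp_of_sqrt_le`: failure probability `≤ n³ 2^{-⌊(k-1)/2⌋} → 0`), whose
hypothesis is literally the unfolding of `InSqrtRegime c k`.

`aks_recovery` is the main theorem (Theorem 1.1 / §2, Algorithms A and B): a probabilistic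
polynomial-time algorithm recovers the planted set with probability `→ 1`. The discharge
`aks_recovery_holds` assembles the PROVED chain
`PlantedCliqueProgram` (the functional AKS program `AKSProg.output s`: all `s`-subsets as seeds,
exact integer power iteration on `B = 2A - J + I` over the common neighbourhood, top-`k'`
selection, `3k'/4` clean-up, clique validation, largest clique wins) →
`PlantedCliqueProgramFP` (`AKSProg.exists_fp_output`: some `f ∈ FP` computes it on
`boolPair 1ⁿ w`, in the `CodeFP` calculus) →
`PlantedCliqueSuccess` (`tendsto_success`: for `5000/c ≤ 2ʲ`, seed length `2j`, the program
returns the planted set with probability `→ 1`, via the spectral core `PlantedCliqueSpectralCore`,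
the bad events `PlantedCliqueEvents{,Norm}` with the random sign-matrix norm bound
`RandomSignMatrixNorm`, and uniqueness `PlantedCliqueUnique`).
The algorithm is the coin-free `RandAlg.ofDet f` (PPT by `RandAlg.IsPolyTime.ofDet_holds`), and
`recoverProb (ofDet f) k n` is literally the success probability of the program
(`recoverProb_ofDet`). This file introduces no definitions and no named facts.

## References

* N. Alon, M. Krivelevich, B. Sudakov, *Finding a large hidden clique in a random graph*, Random
  Structures Algorithms 13 (1998) 457–466, §1, §2 (Theorem/Algorithms A, B), §3
  [AlonKrivelevichSudakov1998].
-/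

namespace Literature.Probability.RandomGraphs.PlantedClique

open Literature.Computability.Complexity Filter Topology
open scoped ENNReal

/-- **Alon–Krivelevich–Sudakov (1998), uniqueness clause — discharge of `aks_unique`.** For every
`c > 0` and every `k : ℕ → ℕ` with `c √n ≤ k n ≤ n` for all large `n`, the planted `k n`-set is
the unique maximum clique of `G(n, 1/2, k n)` with probability tending to `1`; by the first-moment
bound `plantedCliqueUniqueWhp_of_sqrt_le`.
[cite: AlonKrivelevichSudakov1998, §1 (main result, uniqueness clause) and §3] -/
theorem aks_unique_holds : aks_unique :=
  fun _c hc _k hk => plantedCliqueUniqueWhp_of_sqrt_le hc hk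

/-- **The recovery probability of a coin-free algorithm computing the AKS program** is the
success probability of the program under `G(n, 1/2, k n)`. [folklore] -/
theorem recoverProb_ofDet {f : List Bool → List Bool} {s : ℕ}
    (hf : ∀ (n : ℕ) (w : List Bool), f (boolPair (_root_.Computability.unaryEncodeNat n) w) =
      AKSProg.output s (n, w))
    (k : ℕ → ℕ) (n : ℕ) :
    recoverProb (RandAlg.ofDet f) k n =
      ((plantedCliqueJoint n (k n)).toOuterMeasure
        {p | decodeVertexSet n (AKSProg.output s (n, encodeEdgeVec p.2)) = p.1}).toReal := by
  rw [recoverProb]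
  congr 1
  rw [PMF.toOuterMeasure_bind_apply, PMF.toOuterMeasure_apply]
  refine tsum_congr fun p => ?_
  rw [RandAlg.outputPMF_ofDet, PMF.pure_map, PMF.toOuterMeasure_pure_apply, hf]
  by_cases h : decodeVertexSet n (AKSProg.output s (n, encodeEdgeVec p.2)) = p.1
  · rw [Set.indicator_of_mem (show p ∈ {q : Finset (Fin n) × EdgeVec n |
        decodeVertexSet n (AKSProg.output s (n, encodeEdgeVec q.2)) = q.1} from h),
      if_pos (by simp [h]), mul_one]
  · rw [Set.indicator_of_notMem (show p ∉ {q : Finset (Fin n) × EdgeVec n |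
        decodeVertexSet n (AKSProg.output s (n, encodeEdgeVec q.2)) = q.1} from h),
      if_neg (by simp [h]), mul_zero]

/-- **Alon–Krivelevich–Sudakov (1998), main theorem — discharge of `aks_recovery`.** For every
`c > 0` and every clique-size sequence `k` with `c √n ≤ k n ≤ n` eventually there is a
probabilistic polynomial-time algorithm recovering the planted `k n`-set of `G(n, 1/2, k n)` with
probability `→ 1`: the (coin-free) AKS program with seed length `s = 2j`, `2ʲ ≥ 5000/c`.
[cite: AlonKrivelevichSudakov1998, §1 (Theorem) and §2 (Algorithms A and B)] -/
theorem aks_recovery_holds : aks_recovery := by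
  intro c hc k hk
  obtain ⟨j, hj⟩ : ∃ j : ℕ, 5000 / c ≤ (2 : ℝ) ^ j := by
    obtain ⟨j, hj⟩ := pow_unbounded_of_one_lt (5000 / c) (one_lt_two (α := ℝ))
    exact ⟨j, hj.le⟩
  obtain ⟨f, hf, hfout⟩ := AKSProg.exists_fp_output (2 * j)
  refine ⟨RandAlg.ofDet f, RandAlg.IsPolyTime.ofDet_holds hf, ?_⟩
  have hsucc := tendsto_success hc hj hk
  have hreal := (ENNReal.tendsto_toReal ENNReal.one_ne_top).comp hsucc
  rw [ENNReal.toReal_one] at hreal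
  refine hreal.congr fun n => ?_
  rw [Function.comp_apply, recoverProb_ofDet hfout]

end Literature.Probability.RandomGraphs.PlantedClique
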